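import Mathlib
import Summits.NavierStokesRegularity.OSWSelfSimilar.SheetNSLineTorusCascadeTailAggregate
import HarnessLib

/-!
# Viscous CLM on the torus (`a = 0`, `σ = 2`): TWO-SIDED DUHAMEL CELL ENVELOPES with carry — the real-analysis side of the
# reflective (kernel-evaluated) interval certificate

HONEST FRAMING (cell ns-blowup GROUP B «PROFILE SEARCH», zone Z3, row Z3-U addendum A-F2 of `HOME/profile/z3/CENSUS-Z3.md`;
human rulings D-0035/D-0074; Z3-TWIN lineage, eng-5 g13): **1-D MODEL (viscous Constantin–Lax–Majda equation
`ω_t = ω Hω + ν ω_xx` on `𝕋`); ODE calculus on Fourier-coefficient families, kernel-checked; not Euler, not Navier–Stokes;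
«violates: none — MODEL».**

OBJECT: the sine-datum cascade `IsSineCascade ν c e` (`SheetNSLineTorusCascade`): `ė_k = ½ Σ_{i+j=k} e_i e_j − νk² e_k`, `e_k ≥ 0`.
On a time cell `[t₀, t₁]` write `w(t) = e^{−νk²(t−t₀)} ∈ [w(t₁), 1]`. If the driving convolution of mode `k` is pinched
`φ ≤ ½Σ_{i+j=k} e_i e_j ≤ Φ` on the cell and `ℓ ≤ e_k(t₀) ≤ u`, then (Duhamel)
`w ℓ + (1 − w) φ/(νk²) ≤ e_k(t) ≤ w u + (1 − w) Φ/(νk²)` — both sides AFFINE in `w`, so the in-cell infimum / supremum sit at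
`w ∈ {w(t₁), 1}`. This file proves exactly the read-outs a fixed-point checker needs when it only knows a BRACKET
`ρlo ≤ w(t₁) ≤ ρhi` and ROUNDED quantities `φ' ≤ φ/(νk²)`, `Φ/(νk²) ≤ Φ'`:

* `duhamel_window_ub_carry` — the upper companion of `duhamel_window_lb_carry` (p535335): `e_k(t) ≤ w u + Φ(1 − w)/(νk²)`;
* `cell_lb_readout` — from `nlo ≤ φ'(1 − ρhi) + ℓ ρlo`: `nlo ≤ e_k(t₁)` and `min ℓ nlo ≤ e_k(s)` on the cell;
* `cell_ub_readout` — from `Φ'(1 − ρlo) + u ρhi ≤ nup`: `e_k(t₁) ≤ nup` and `e_k(s) ≤ max u nup` on the cell;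
* `ray_ub_readout` — on a ray `[t₀, ∞)`: `e_k(s) ≤ max u Φ'`;
* `exp_neg_sq_mul_log_eq_pow` — with `ν = 1` and cell length `δ = log(2^j/a)` the weight is EXACTLY dyadic-rational:
  `e^{−k²·n·δ}… = (a/2^j)^{k²}` (so a checker never evaluates `exp`);
* `mode_one_bounds` — mode `1` is `c e^{−νt}` (`mode_one`), pinched on a cell by its end values.
bears_on: LADDER-NS N5 / zone Z3 (row Z3-U) → N1 linear core. WHAT THIS IS NOT: not NS; no number certified by THIS file; no definitions.
-/

namespace Summit.NavierStokesRegularity.OSWSelfSimilar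
namespace SheetNSLineTorusCascade

open Finset Real Set

variable {ν c : ℝ} {e : ℕ → ℝ → ℝ}

/-! ### The upper Duhamel window bound with carry -/

/-- **DUHAMEL WINDOW UPPER BOUND WITH CARRY (convex form).** If `e_k(t₀) ≤ u` and `½ Σ_{i+j=k} e_i e_j ≤ Φ` on `[t₀, T]`
(`k ≥ 1`, `t₀ ≥ 0`, `ν > 0`), then for every `t ∈ [t₀, T]`,
`e_k(t) ≤ e^{−νk²(t−t₀)} u + Φ (1 − e^{−νk²(t−t₀)})/(νk²)` (`e^{νk²s} e_k(s) − Φ e^{νk²s}/(νk²)` is non-increasing).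
Sharper than `super_step` (which drops the factor `1 − e^{−νk²(t−t₀)}`), and exactly invertible cell by cell. [new here — MODEL] -/
theorem duhamel_window_ub_carry (he : IsSineCascade ν c e) (hν : 0 < ν) {k : ℕ} (hk : 1 ≤ k)
    {t₀ T Φ u : ℝ} (ht₀ : 0 ≤ t₀) (hu : e k t₀ ≤ u)
    (hΦ : ∀ s ∈ Icc t₀ T, (1 / 2) * ∑ p ∈ antidiagonal k, e p.1 s * e p.2 s ≤ Φ) :
    ∀ t ∈ Icc t₀ T, e k t ≤ exp (-(ν * (k : ℝ) ^ 2 * (t - t₀))) * u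
      + Φ * (1 - exp (-(ν * (k : ℝ) ^ 2 * (t - t₀)))) / (ν * (k : ℝ) ^ 2) := by
  intro t ht
  have hkpos : (0 : ℝ) < k := by exact_mod_cast hk
  have hκ : 0 < ν * (k : ℝ) ^ 2 := by positivity
  have hκ0 : ν * (k : ℝ) ^ 2 ≠ 0 := hκ.ne'
  set D : ℝ → ℝ := fun s => exp (ν * (k : ℝ) ^ 2 * s) * e k s with hD
  set G : ℝ → ℝ := fun s => Φ * exp (ν * (k : ℝ) ^ 2 * s) / (ν * (k : ℝ) ^ 2) with hG
  have hG' : ∀ s, HasDerivAt G (Φ * (exp (ν * (k : ℝ) ^ 2 * s) * (ν * (k : ℝ) ^ 2)) / (ν * (k : ℝ) ^ 2)) s := by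
    intro s
    have := ((((hasDerivAt_id s).const_mul (ν * (k : ℝ) ^ 2)).exp.const_mul Φ).div_const (ν * (k : ℝ) ^ 2))
    simpa using this
  have hGcont : Continuous G :=
    (continuous_const.mul (continuous_exp.comp (continuous_const.mul continuous_id))).div_const _
  have hanti : AntitoneOn (fun s => D s - G s) (Icc t₀ T) := by
    refine antitoneOn_of_hasDerivWithinAt_nonpos
      (f' := fun s => exp (ν * (k : ℝ) ^ 2 * s) * ((1 / 2) * ∑ p ∈ antidiagonal k, e p.1 s * e p.2 s)
        - Φ * (exp (ν * (k : ℝ) ^ 2 * s) * (ν * (k : ℝ) ^ 2)) / (ν * (k : ℝ) ^ 2))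
      (convex_Icc t₀ T) ?_ (fun s hs => ?_) (fun s hs => ?_)
    · exact ((continuousOn_weighted he k).mono fun s hs => (le_trans ht₀ hs.1 : (0 : ℝ) ≤ s)).sub hGcont.continuousOn
    · rw [interior_Icc] at hs ⊢
      exact ((hasDerivAt_weighted he k (lt_of_le_of_lt ht₀ hs.1)).sub (hG' s)).hasDerivWithinAt
    · rw [interior_Icc] at hs
      have hΦs := hΦ s ⟨hs.1.le, hs.2.le⟩
      have hid : Φ * (exp (ν * (k : ℝ) ^ 2 * s) * (ν * (k : ℝ) ^ 2)) / (ν * (k : ℝ) ^ 2)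
          = exp (ν * (k : ℝ) ^ 2 * s) * Φ := by
        field_simp
      rw [hid, ← mul_sub]
      exact mul_nonpos_iff.mpr (Or.inl ⟨(exp_pos _).le, by linarith⟩)
  have hmain : D t ≤ G t - G t₀ + D t₀ := by
    have hmem₀ : t₀ ∈ Icc t₀ T := ⟨le_rfl, le_trans ht.1 ht.2⟩
    have := hanti hmem₀ ht ht.1
    simp only at this
    linarith
  have e1 : exp (-(ν * (k : ℝ) ^ 2 * t)) * exp (ν * (k : ℝ) ^ 2 * t) = 1 := by
    rw [← exp_add]; simp
  have e2 : exp (-(ν * (k : ℝ) ^ 2 * t)) * exp (ν * (k : ℝ) ^ 2 * t₀) = exp (-(ν * (k : ℝ) ^ 2 * (t - t₀))) := by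
    rw [← exp_add]; congr 1; ring
  have hGt : exp (-(ν * (k : ℝ) ^ 2 * t)) * (G t - G t₀ + D t₀)
      = exp (-(ν * (k : ℝ) ^ 2 * (t - t₀))) * e k t₀
        + Φ * (1 - exp (-(ν * (k : ℝ) ^ 2 * (t - t₀)))) / (ν * (k : ℝ) ^ 2) := by
    have step : exp (-(ν * (k : ℝ) ^ 2 * t)) * (G t - G t₀ + D t₀)
        = Φ / (ν * (k : ℝ) ^ 2) * (exp (-(ν * (k : ℝ) ^ 2 * t)) * exp (ν * (k : ℝ) ^ 2 * t)
          - exp (-(ν * (k : ℝ) ^ 2 * t)) * exp (ν * (k : ℝ) ^ 2 * t₀))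
          + (exp (-(ν * (k : ℝ) ^ 2 * t)) * exp (ν * (k : ℝ) ^ 2 * t₀)) * e k t₀ := by
      simp only [hG, hD]; ring
    rw [step, e1, e2]
    ring
  have hekt : exp (-(ν * (k : ℝ) ^ 2 * t)) * D t = e k t := by
    simp only [hD]
    rw [← mul_assoc, e1, one_mul]
  have hw0 : 0 ≤ exp (-(ν * (k : ℝ) ^ 2 * (t - t₀))) := (exp_pos _).le
  calc e k t = exp (-(ν * (k : ℝ) ^ 2 * t)) * D t := hekt.symm
    _ ≤ exp (-(ν * (k : ℝ) ^ 2 * t)) * (G t - G t₀ + D t₀) := mul_le_mul_of_nonneg_left hmain (exp_pos _).le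
    _ = exp (-(ν * (k : ℝ) ^ 2 * (t - t₀))) * e k t₀
        + Φ * (1 - exp (-(ν * (k : ℝ) ^ 2 * (t - t₀)))) / (ν * (k : ℝ) ^ 2) := hGt
    _ ≤ exp (-(ν * (k : ℝ) ^ 2 * (t - t₀))) * u
        + Φ * (1 - exp (-(ν * (k : ℝ) ^ 2 * (t - t₀)))) / (ν * (k : ℝ) ^ 2) := by
        have := mul_le_mul_of_nonneg_left hu hw0
        linarith

/-! ### Affine read-outs from a bracket of the end weight -/

/-- An affine function `w ↦ p + (q − p)·w` on `[w₁, 1]` is bounded below by the minimum of its end values. [folklore] -/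
theorem affine_ge_min_ends {p q w w₁ : ℝ} (hw₁ : w₁ ≤ w) (hw : w ≤ 1) :
    min q (p + (q - p) * w₁) ≤ p + (q - p) * w := by
  rcases le_total p q with hpq | hpq
  · have : p + (q - p) * w₁ ≤ p + (q - p) * w := by nlinarith
    exact le_trans (min_le_right _ _) this
  · have : q ≤ p + (q - p) * w := by nlinarith
    exact le_trans (min_le_left _ _) this

/-- An affine function `w ↦ p + (q − p)·w` on `[w₁, 1]` is bounded above by the maximum of its end values. [folklore] -/
theorem affine_le_max_ends {p q w w₁ : ℝ} (hw₁ : w₁ ≤ w) (hw : w ≤ 1) :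
    p + (q - p) * w ≤ max q (p + (q - p) * w₁) := by
  rcases le_total p q with hpq | hpq
  · have : p + (q - p) * w ≤ q := by nlinarith
    exact le_trans this (le_max_left _ _)
  · have : p + (q - p) * w ≤ p + (q - p) * w₁ := by nlinarith
    exact le_trans this (le_max_right _ _)

/-- The cell weight `w(s) = e^{−νk²(s−t₀)}` lies in `[w(t₁), 1]` for `s ∈ [t₀, t₁]` (`νk² ≥ 0`). [folklore] -/
theorem cell_weight_mem {κ t₀ t₁ s : ℝ} (hκ : 0 ≤ κ) (hs : s ∈ Icc t₀ t₁) :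
    exp (-(κ * (t₁ - t₀))) ≤ exp (-(κ * (s - t₀))) ∧ exp (-(κ * (s - t₀))) ≤ 1 := by
  constructor
  · exact exp_le_exp.mpr (by nlinarith [hs.2])
  · rw [exp_le_one_iff]; nlinarith [hs.1]

/-- **LOWER CELL READ-OUT.** Let `k ≥ 1`, `t₀ ≥ 0`, `ν > 0`; `0 ≤ ℓ ≤ e_k(t₀)`; `φ ≤ ½Σ_{i+j=k} e_i e_j` on `[t₀, t₁]`; a rounded
value `0 ≤ φ' ≤ φ/(νk²)`; a bracket `ρlo ≤ e^{−νk²(t₁−t₀)} ≤ ρhi`; and `nlo ≤ φ'(1 − ρhi) + ℓ ρlo`. Then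
`nlo ≤ e_k(t₁)` and `min ℓ nlo ≤ e_k(s)` for every `s ∈ [t₀, t₁]` (each of the two terms is monotone in the weight). [new here — MODEL] -/
theorem cell_lb_readout (he : IsSineCascade ν c e) (hν : 0 < ν) {k : ℕ} (hk : 1 ≤ k)
    {t₀ t₁ φ φ' ℓ ρlo ρhi nlo : ℝ} (ht₀ : 0 ≤ t₀) (ht₁ : t₀ ≤ t₁) (hℓ0 : 0 ≤ ℓ) (hℓ : ℓ ≤ e k t₀)
    (hφ : ∀ s ∈ Icc t₀ t₁, φ ≤ (1 / 2) * ∑ p ∈ antidiagonal k, e p.1 s * e p.2 s)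
    (hφ'0 : 0 ≤ φ') (hφ' : φ' ≤ φ / (ν * (k : ℝ) ^ 2))
    (hρlo : ρlo ≤ exp (-(ν * (k : ℝ) ^ 2 * (t₁ - t₀))))
    (hρhi : exp (-(ν * (k : ℝ) ^ 2 * (t₁ - t₀))) ≤ ρhi)
    (hnlo : nlo ≤ φ' * (1 - ρhi) + ℓ * ρlo) :
    nlo ≤ e k t₁ ∧ ∀ s ∈ Icc t₀ t₁, min ℓ nlo ≤ e k s := by
  have hkpos : (0 : ℝ) < k := by exact_mod_cast hk
  have hκ : 0 < ν * (k : ℝ) ^ 2 := by positivity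
  -- the Duhamel bound as an affine function of the weight, weakened to φ'
  have key : ∀ s ∈ Icc t₀ t₁, φ' + (ℓ - φ') * exp (-(ν * (k : ℝ) ^ 2 * (s - t₀))) ≤ e k s := by
    intro s hs
    have h := duhamel_window_lb_carry he hν hk ht₀ hℓ hφ s hs
    obtain ⟨-, hwle⟩ := cell_weight_mem hκ.le hs
    have h1 : (1 - exp (-(ν * (k : ℝ) ^ 2 * (s - t₀)))) * φ'
        ≤ φ * (1 - exp (-(ν * (k : ℝ) ^ 2 * (s - t₀)))) / (ν * (k : ℝ) ^ 2) := by
      rw [show φ * (1 - exp (-(ν * (k : ℝ) ^ 2 * (s - t₀)))) / (ν * (k : ℝ) ^ 2)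
          = (1 - exp (-(ν * (k : ℝ) ^ 2 * (s - t₀)))) * (φ / (ν * (k : ℝ) ^ 2)) by ring]
      exact mul_le_mul_of_nonneg_left hφ' (by linarith)
    nlinarith
  -- the end value of the affine function dominates nlo
  have hend : nlo ≤ φ' + (ℓ - φ') * exp (-(ν * (k : ℝ) ^ 2 * (t₁ - t₀))) := by
    have := mul_le_mul_of_nonneg_left hρlo hℓ0
    have := mul_le_mul_of_nonneg_left hρhi hφ'0
    nlinarith
  refine ⟨le_trans hend (key t₁ ⟨ht₁, le_rfl⟩), fun s hs => ?_⟩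
  obtain ⟨hw₁, hw1⟩ := cell_weight_mem hκ.le hs
  calc min ℓ nlo ≤ min ℓ (φ' + (ℓ - φ') * exp (-(ν * (k : ℝ) ^ 2 * (t₁ - t₀)))) := min_le_min le_rfl hend
    _ ≤ φ' + (ℓ - φ') * exp (-(ν * (k : ℝ) ^ 2 * (s - t₀))) := affine_ge_min_ends hw₁ hw1
    _ ≤ e k s := key s hs

/-- **UPPER CELL READ-OUT.** Let `k ≥ 1`, `t₀ ≥ 0`, `ν > 0`; `0 ≤ e_k(t₀) ≤ u`; `½Σ_{i+j=k} e_i e_j ≤ Φ` on `[t₀, t₁]`; a rounded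
value `Φ/(νk²) ≤ Φ'` with `0 ≤ Φ'`; a bracket `ρlo ≤ e^{−νk²(t₁−t₀)} ≤ ρhi`; and `Φ'(1 − ρlo) + u ρhi ≤ nup`. Then
`e_k(t₁) ≤ nup` and `e_k(s) ≤ max u nup` for every `s ∈ [t₀, t₁]`. [new here — MODEL] -/
theorem cell_ub_readout (he : IsSineCascade ν c e) (hν : 0 < ν) {k : ℕ} (hk : 1 ≤ k)
    {t₀ t₁ Φ Φ' u ρlo ρhi nup : ℝ} (ht₀ : 0 ≤ t₀) (ht₁ : t₀ ≤ t₁) (hu0 : 0 ≤ u) (hu : e k t₀ ≤ u)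
    (hΦ : ∀ s ∈ Icc t₀ t₁, (1 / 2) * ∑ p ∈ antidiagonal k, e p.1 s * e p.2 s ≤ Φ)
    (hΦ'0 : 0 ≤ Φ') (hΦ' : Φ / (ν * (k : ℝ) ^ 2) ≤ Φ')
    (hρlo : ρlo ≤ exp (-(ν * (k : ℝ) ^ 2 * (t₁ - t₀))))
    (hρhi : exp (-(ν * (k : ℝ) ^ 2 * (t₁ - t₀))) ≤ ρhi)
    (hnup : Φ' * (1 - ρlo) + u * ρhi ≤ nup) :
    e k t₁ ≤ nup ∧ ∀ s ∈ Icc t₀ t₁, e k s ≤ max u nup := by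
  have hkpos : (0 : ℝ) < k := by exact_mod_cast hk
  have hκ : 0 < ν * (k : ℝ) ^ 2 := by positivity
  have key : ∀ s ∈ Icc t₀ t₁, e k s ≤ Φ' + (u - Φ') * exp (-(ν * (k : ℝ) ^ 2 * (s - t₀))) := by
    intro s hs
    have h := duhamel_window_ub_carry he hν hk ht₀ hu hΦ s hs
    obtain ⟨-, hwle⟩ := cell_weight_mem hκ.le hs
    have h1 : Φ * (1 - exp (-(ν * (k : ℝ) ^ 2 * (s - t₀)))) / (ν * (k : ℝ) ^ 2)
        ≤ (1 - exp (-(ν * (k : ℝ) ^ 2 * (s - t₀)))) * Φ' := by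
      rw [show Φ * (1 - exp (-(ν * (k : ℝ) ^ 2 * (s - t₀)))) / (ν * (k : ℝ) ^ 2)
          = (1 - exp (-(ν * (k : ℝ) ^ 2 * (s - t₀)))) * (Φ / (ν * (k : ℝ) ^ 2)) by ring]
      exact mul_le_mul_of_nonneg_left hΦ' (by linarith)
    nlinarith
  have hend : Φ' + (u - Φ') * exp (-(ν * (k : ℝ) ^ 2 * (t₁ - t₀))) ≤ nup := by
    have := mul_le_mul_of_nonneg_left hρhi hu0
    have := mul_le_mul_of_nonneg_left hρlo hΦ'0
    nlinarith
  refine ⟨le_trans (key t₁ ⟨ht₁, le_rfl⟩) hend, fun s hs => ?_⟩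
  obtain ⟨hw₁, hw1⟩ := cell_weight_mem hκ.le hs
  calc e k s ≤ Φ' + (u - Φ') * exp (-(ν * (k : ℝ) ^ 2 * (s - t₀))) := key s hs
    _ ≤ max u (Φ' + (u - Φ') * exp (-(ν * (k : ℝ) ^ 2 * (t₁ - t₀)))) := affine_le_max_ends hw₁ hw1
    _ ≤ max u nup := max_le_max le_rfl hend

/-- **RAY READ-OUT.** On a ray `[t₀, ∞)`: if `0 ≤ e_k(t₀) ≤ u`, `½Σ_{i+j=k} e_i e_j ≤ Φ` for all `s ≥ t₀`, and `Φ/(νk²) ≤ Φ'`, then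
`e_k(s) ≤ max u Φ'` for every `s ≥ t₀` (`k ≥ 1`, `t₀ ≥ 0`, `ν > 0`). [new here — MODEL] -/
theorem ray_ub_readout (he : IsSineCascade ν c e) (hν : 0 < ν) {k : ℕ} (hk : 1 ≤ k)
    {t₀ Φ Φ' u : ℝ} (ht₀ : 0 ≤ t₀) (hu : e k t₀ ≤ u)
    (hΦ : ∀ s, t₀ ≤ s → (1 / 2) * ∑ p ∈ antidiagonal k, e p.1 s * e p.2 s ≤ Φ)
    (hΦ' : Φ / (ν * (k : ℝ) ^ 2) ≤ Φ') :
    ∀ s, t₀ ≤ s → e k s ≤ max u Φ' := by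
  intro s hs
  have hkpos : (0 : ℝ) < k := by exact_mod_cast hk
  have hκ : 0 < ν * (k : ℝ) ^ 2 := by positivity
  have h := duhamel_window_ub_carry he hν hk ht₀ hu (T := s) (fun σ hσ => hΦ σ hσ.1) s ⟨hs, le_rfl⟩
  obtain ⟨-, hw1⟩ := cell_weight_mem (t₁ := s) hκ.le (⟨hs, le_rfl⟩ : s ∈ Icc t₀ s)
  have hw0 : 0 ≤ exp (-(ν * (k : ℝ) ^ 2 * (s - t₀))) := (exp_pos _).le
  have h1 : Φ * (1 - exp (-(ν * (k : ℝ) ^ 2 * (s - t₀)))) / (ν * (k : ℝ) ^ 2)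
      ≤ (1 - exp (-(ν * (k : ℝ) ^ 2 * (s - t₀)))) * Φ' := by
    rw [show Φ * (1 - exp (-(ν * (k : ℝ) ^ 2 * (s - t₀)))) / (ν * (k : ℝ) ^ 2)
        = (1 - exp (-(ν * (k : ℝ) ^ 2 * (s - t₀)))) * (Φ / (ν * (k : ℝ) ^ 2)) by ring]
    exact mul_le_mul_of_nonneg_left hΦ' (by linarith)
  have hu' : u ≤ max u Φ' := le_max_left _ _
  have hΦ'' : Φ' ≤ max u Φ' := le_max_right _ _
  nlinarith [mul_le_mul_of_nonneg_left hu' hw0, mul_le_mul_of_nonneg_left hΦ'' (by linarith : (0:ℝ) ≤ 1 - exp (-(ν * (k : ℝ) ^ 2 * (s - t₀))))]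

/-! ### Exact dyadic weights and mode one -/

/-- With cell length `δ = log(2^j / a)` (`0 < a`), `e^{−(m·δ)} = (a / 2^j)^m`: the decay weights of the chain are exactly
rational, so a checker never evaluates `exp`. [folklore] -/
theorem exp_neg_mul_log_dyadic (m : ℕ) {a : ℝ} (ha : 0 < a) (j : ℕ) :
    exp (-((m : ℝ) * Real.log (2 ^ j / a))) = (a / 2 ^ j) ^ m := by
  have h2 : (0 : ℝ) < 2 ^ j := by positivity
  have hq : (0 : ℝ) < 2 ^ j / a := div_pos h2 ha
  have hpos : (0 : ℝ) < a / 2 ^ j := div_pos ha h2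
  have hlog : Real.log (a / 2 ^ j) = -Real.log (2 ^ j / a) := by rw [← inv_div, Real.log_inv]
  rw [show -((m : ℝ) * Real.log (2 ^ j / a)) = Real.log (a / 2 ^ j) * (m : ℝ) by rw [hlog]; ring,
    ← Real.rpow_def_of_pos hpos, Real.rpow_natCast]

/-- `0 ≤ log(2^j / a)` when `0 < a ≤ 2^j`: cell lengths are nonnegative. [folklore] -/
theorem log_dyadic_nonneg {a : ℝ} (ha : 0 < a) (j : ℕ) (haj : a ≤ 2 ^ j) : 0 ≤ Real.log (2 ^ j / a) :=
  Real.log_nonneg ((one_le_div ha).mpr haj)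

/-- **Mode one on a cell.** For a sine cascade, `e_1(s) = c e^{−νs}`; hence on `[t₀, t₁]` (`0 ≤ t₀`, `0 ≤ c`, `0 ≤ ν`):
`c e^{−νt₁} ≤ e_1(s) ≤ c e^{−νt₀}`. [new here — MODEL] -/
theorem mode_one_bounds (he : IsSineCascade ν c e) (hν : 0 ≤ ν) (hc : 0 ≤ c) {t₀ t₁ s : ℝ} (ht₀ : 0 ≤ t₀)
    (hs : s ∈ Icc t₀ t₁) :
    c * exp (-(ν * t₁)) ≤ e 1 s ∧ e 1 s ≤ c * exp (-(ν * t₀)) := by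
  rw [mode_one he s (le_trans ht₀ hs.1)]
  constructor
  · exact mul_le_mul_of_nonneg_left (exp_le_exp.mpr (by nlinarith [hs.2])) hc
  · exact mul_le_mul_of_nonneg_left (exp_le_exp.mpr (by nlinarith [hs.1])) hc

end SheetNSLineTorusCascade
end Summit.NavierStokesRegularity.OSWSelfSimilar
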